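import Literature.MathematicalPhysics.QuantumFieldTheory.Balaban1983to89.Node00.Record12MeasurabilityAnySelector
import Literature.MathematicalPhysics.QuantumFieldTheory.Balaban1983to89.Node00.Record9ProvisosOfRegularity

/-!
# NODE 00 — TWO-SIDED SANDWICHES THROUGH ONE STEP OF THE REPRESENTED TOWER: a slot family squeezed between positive multiples of another,
# `m·f₁ ≤ f₂ ≤ M·f₁`, stays squeezed after the 𝐓-step (same constants) and after def-R's 𝐑-step at ANY common selector (constants `m²∕M`, `M²∕m`)

Cell `pub-ymgap`, YM-PLAN Track A (HUMAN RULING D-0062); author seat `pub-ymgap-dag-n20-d` (g37, the N20 lineage), dag-lead g32 WORDS 286 (INTENT-7 assigned: the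
dressed ∕ undressed COMPARABILITY, of which this file is the one-step half; the induction and its consequences are the companion `Node00/DressedUndressedComparability`).
Objects: def-T's `tstepOfRecord` (`Node00/TStepOfRecord`, unfolding `texpASucc_apply`; regularity `Record9ProvisosOfRegularity`), def-R's `rstepSlot ∕ sliceOfRecord ∕ fibOfSeq ∕
rratio ∕ rterm`, b01's `fibreIntegral`.  [III] = [Balaban1988Convergent]; [IV] = [Balaban1989LargeFieldI].

WHY.  The dressed (2.18) slot family of a datum (`DressedSlotsOfRecord12.dressedSlotsOfDatum₉`, start `e^{tF}·e^{−A∕g₀²}`) and the undressed tower of record (start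
`e^{−E}·e^{−A∕g₀²}`) run through the SAME steps; at level `0` they are squeezed (`|F| ≤ 1`).  If the squeeze survives every step, the two families have the same zero sets, the
same live sequences, and the undressed provisos (non-negativity, bounds, nowhere-zero denominators, the live selector's prefix preservation) transfer to the dressed family —
the last structural inputs of hypothesis (T) of the N20 lineage's tower sockets (`Node00/DressedClassTelescoping`).  This file proves the two ONE-STEP squeezes.

WHAT IS PROVED (elementary real analysis + Mathlib `lmarginal` ∕ Bochner bookkeeping; TS-8 explicit `iP` binders on the generic fibre-integral lemmas).
* §1 `fibreIntegral_mono` (pointwise `f ≤ g`, `g` bounded ⇒ `∫⌈f ≤ ∫⌈g`), `fibreIntegral_const_mul` (`∫⌈(c·f) = c·∫⌈f`, `c ≥ 0`, `f` measurable), `fibreIntegral_sandwich`,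
  private `div_sandwich` (the ratio of two squeezed non-negative quantities is squeezed, with the `x∕0 = 0` convention on both sides), private `mul_sandwich`.
* §2 ★ `rstepSlot_sandwich`: at ANY selector `sel`, `m·f₁ ≤ f₂ ≤ M·f₁` (`0 < m ≤ M`; `f₁ ≥ 0` bounded, measurable; `χ_k` measurable) ⇒
  `(m²∕M)·𝐑f₁ ≤ 𝐑f₂ ≤ (M²∕m)·𝐑f₁` pointwise ([IV] (0.3): the slot times a sum of fibre-integral ratios, each squeezed by `div_sandwich`).
* §3 ★ `tstepOfRecord_sandwich`: `m·T₁ ≤ T₂ ≤ M·T₁` (`0 ≤ m`; `T₁ ≥ 0` bounded measurable, `T₂` measurable; `0 ≤ w`, `|w| ≤ 1` jointly measurable; `χ_k` measurable) ⇒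
  `m·(†)T₁ ≤ (†)T₂ ≤ M·(†)T₁` pointwise ([III] (3.1): the averaging kernel is Markov, the integrands bounded measurable — `integral_mono`).

HONEST FRAMING.  Kernel bookkeeping; every regularity clause is a HYPOTHESIS; nothing of Bałaban's asserted; no estimate; no `Provisos` inhabitant claimed; counts UNMOVED
(typed 28∕28 · discharged 8∕27); one finite four-torus programme at fixed `ε` — NOT ℝ⁴ ∕ OS ∕ mass gap ∕ Clay.  No `def`, no `sorry`, no `axiom`, no `instance`, no `notation`.
-/

noncomputable section

open MeasureTheory ProbabilityTheory Function
open scoped BigOperators ENNReal NNReal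

namespace Literature.MathematicalPhysics.QuantumFieldTheory.Balaban1983to89.Node00

open T4Continuum B14.Eq218Concrete B15RopTotal T4AveragingDisintegration T4FiniteEpsInhabited
open B15.BasicStep (fibreIntegral lmarginal_ofReal_le ofReal_comp_measurable lmarginal_mul_of_indepOf IndepOf)

/-! ## §1 Fibre integrals are monotone and homogeneous; squeezed ratios and products -/

section Fibre

variable {P : Params} {G : Type*} [GaugeGroup G] [MeasurableSpace G] [HaarData G] {j : ℕ}

/-- Monotonicity of the fibre integral `∫⌈_{Z′}` in the density, for a bounded majorant (so that no value `∞` is truncated by `toReal`); the bond-decidability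
instance is implicit (unified from the goal, def-R's TS-8 convention). [cite: Balaban1989LargeFieldI, (0.3) p.176 (bookkeeping)] -/
theorem fibreIntegral_mono {iP : DecidableEq (PBond P j)} (s : Finset (PBond P j)) {f g : Density P j G} (hfg : ∀ U, f U ≤ g U) {C : ℝ}
    (hgC : ∀ U, g U ≤ C) (V : GaugeField P j G) : fibreIntegral s f V ≤ fibreIntegral s g V := by
  unfold fibreIntegral
  exact ENNReal.toReal_mono (ne_top_of_le_ne_top ENNReal.ofReal_ne_top (lmarginal_ofReal_le s hgC V))
    (lmarginal_mono (fun U => ENNReal.ofReal_le_ofReal (hfg U)) V)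

/-- Homogeneity of the fibre integral: `∫⌈_{Z′}(c·f) = c·∫⌈_{Z′} f` for `c ≥ 0` and measurable `f` (a constant is fibre-independent; b01's `lmarginal_mul_of_indepOf`).
[cite: Balaban1989LargeFieldI, (0.3) p.176 (bookkeeping)] -/
theorem fibreIntegral_const_mul {iP : DecidableEq (PBond P j)} (s : Finset (PBond P j)) {f : Density P j G} (hf : Measurable f) {c : ℝ} (hc : 0 ≤ c)
    (V : GaugeField P j G) : fibreIntegral s (fun U => c * f U) V = c * fibreIntegral s f V := by
  unfold fibreIntegral
  have hfun : (fun U : PBond P j → G => ENNReal.ofReal (c * f U)) =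
      (fun _ : PBond P j → G => ENNReal.ofReal c) * fun U : PBond P j → G => ENNReal.ofReal (f U) := by
    funext U
    simp only [Pi.mul_apply, ENNReal.ofReal_mul hc]
  have hind : IndepOf s (fun _ : PBond P j → G => ENNReal.ofReal c) := fun _ _ => rfl
  have hg : Measurable (fun U : PBond P j → G => ENNReal.ofReal (f U)) := ENNReal.measurable_ofReal.comp hf
  rw [hfun, lmarginal_mul_of_indepOf s hind hg]
  simp only [Pi.mul_apply, ENNReal.toReal_mul, ENNReal.toReal_ofReal hc]

/-- `∫⌈_{Z′} f ≥ 0` (a `toReal`). [cite: Balaban1989LargeFieldI, (0.3) p.176 (bookkeeping)] -/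
theorem fibreIntegral_nonneg' {iP : DecidableEq (PBond P j)} (s : Finset (PBond P j)) (f : Density P j G) (V : GaugeField P j G) :
    0 ≤ fibreIntegral s f V :=
  ENNReal.toReal_nonneg

/-- TWO-SIDED SQUEEZE OF FIBRE INTEGRALS: `m·t₁ ≤ t₂ ≤ M·t₁` pointwise (`0 ≤ m`, `0 ≤ M`; `t₁` bounded measurable) gives
`m·∫⌈t₁ ≤ ∫⌈t₂ ≤ M·∫⌈t₁` at every fibre set and configuration. [cite: Balaban1989LargeFieldI, (0.3) p.176 (bookkeeping)] -/
theorem fibreIntegral_sandwich {iP : DecidableEq (PBond P j)} (s : Finset (PBond P j)) {t₁ t₂ : Density P j G} {C : ℝ}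
    (hC : ∀ U, t₁ U ≤ C) (ht₁ : Measurable t₁) {m M : ℝ} (hm : 0 ≤ m) (hM : 0 ≤ M) (hl : ∀ U, m * t₁ U ≤ t₂ U) (hu : ∀ U, t₂ U ≤ M * t₁ U)
    (V : GaugeField P j G) : m * fibreIntegral s t₁ V ≤ fibreIntegral s t₂ V ∧ fibreIntegral s t₂ V ≤ M * fibreIntegral s t₁ V := by
  have hMC : ∀ U, M * t₁ U ≤ M * C := fun U => mul_le_mul_of_nonneg_left (hC U) hM
  constructor
  · rw [← fibreIntegral_const_mul s ht₁ hm V]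
    exact fibreIntegral_mono s hl (fun U => (hu U).trans (hMC U)) V
  · rw [← fibreIntegral_const_mul s ht₁ hM V]
    exact fibreIntegral_mono s hu hMC V

omit [GaugeGroup G] [MeasurableSpace G] [HaarData G] in
/-- SQUEEZED RATIOS: non-negative `N₁, D₁` and quantities squeezed as `m·N₁ ≤ N₂ ≤ M·N₁`, `m·D₁ ≤ D₂ ≤ M·D₁` with `0 < m ≤ M` have
`(m∕M)·(N₁∕D₁) ≤ N₂∕D₂ ≤ (M∕m)·(N₁∕D₁)` — with the convention `x∕0 = 0` on both sides (a vanishing `D₁` forces a vanishing `D₂`); real-arithmetic plumbing. [folklore] -/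
private theorem div_sandwich {N₁ N₂ D₁ D₂ m M : ℝ} (hm : 0 < m) (hmM : m ≤ M) (hN₁ : 0 ≤ N₁) (hD₁ : 0 ≤ D₁)
    (hNl : m * N₁ ≤ N₂) (hNu : N₂ ≤ M * N₁) (hDl : m * D₁ ≤ D₂) (hDu : D₂ ≤ M * D₁) :
    m / M * (N₁ / D₁) ≤ N₂ / D₂ ∧ N₂ / D₂ ≤ M / m * (N₁ / D₁) := by
  have hM : 0 < M := lt_of_lt_of_le hm hmM
  rcases eq_or_lt_of_le hD₁ with hD | hD
  · -- `D₁ = 0` forces `D₂ = 0`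
    have hD₂0 : D₂ ≤ 0 := by rw [← hD, mul_zero] at hDu; exact hDu
    have hD₂1 : 0 ≤ D₂ := by rw [← hD, mul_zero] at hDl; exact hDl
    have hD₂ : D₂ = 0 := le_antisymm hD₂0 hD₂1
    simp [← hD, hD₂]
  · have hD₂ : 0 < D₂ := lt_of_lt_of_le (mul_pos hm hD) hDl
    have hN₂ : 0 ≤ N₂ := le_trans (mul_nonneg hm.le hN₁) hNl
    constructor
    · rw [← mul_div_mul_comm]
      exact div_le_div₀ hN₂ hNl hD₂ hDu
    · rw [← mul_div_mul_comm]
      exact div_le_div₀ (mul_nonneg hM.le hN₁) hNu (mul_pos hm hD) hDl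

omit [GaugeGroup G] [MeasurableSpace G] [HaarData G] in
/-- SQUEEZED PRODUCTS: `m·a₁ ≤ a₂ ≤ M·a₁` (`a₁ ≥ 0`) and `(m∕M)·S₁ ≤ S₂ ≤ (M∕m)·S₁` (`S₁ ≥ 0`), `0 < m ≤ M`, give
`(m·m∕M)·(a₁·S₁) ≤ a₂·S₂ ≤ (M·M∕m)·(a₁·S₁)`; real-arithmetic plumbing. [folklore] -/
private theorem mul_sandwich {a₁ a₂ S₁ S₂ m M : ℝ} (hm : 0 < m) (hmM : m ≤ M) (ha₁ : 0 ≤ a₁) (hS₁ : 0 ≤ S₁)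
    (hal : m * a₁ ≤ a₂) (hau : a₂ ≤ M * a₁) (hSl : m / M * S₁ ≤ S₂) (hSu : S₂ ≤ M / m * S₁) :
    m * m / M * (a₁ * S₁) ≤ a₂ * S₂ ∧ a₂ * S₂ ≤ M * M / m * (a₁ * S₁) := by
  have hM : 0 < M := lt_of_lt_of_le hm hmM
  have ha₂ : 0 ≤ a₂ := le_trans (mul_nonneg hm.le ha₁) hal
  have hS₂ : 0 ≤ S₂ := le_trans (mul_nonneg (div_nonneg hm.le hM.le) hS₁) hSl
  constructor
  · calc m * m / M * (a₁ * S₁) = (m * a₁) * (m / M * S₁) := by ring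
      _ ≤ a₂ * S₂ := mul_le_mul hal hSl (mul_nonneg (div_nonneg hm.le hM.le) hS₁) ha₂
  · calc a₂ * S₂ ≤ (M * a₁) * (M / m * S₁) := mul_le_mul hau hSu hS₂ (mul_nonneg hM.le ha₁)
      _ = M * M / m * (a₁ * S₁) := by ring

end Fibre

/-! ## §2 The 𝐑-step at any selector keeps a two-sided squeeze -/

variable (F : T4Family) (N : ℕ) [NeZero N]

section RStep

variable (ν : Stage7Numerics) (τ : TowerNumerics) {p : B12.RunParams} {g : ℕ → ℝ} {k : ℕ}

open scoped Classical in
/-- ★ **THE 𝐑-STEP OF RECORD KEEPS A TWO-SIDED SQUEEZE, AT ANY SELECTOR.**  If `m·f₁ ≤ f₂ ≤ M·f₁` slot-wise and pointwise (`0 < m ≤ M`), with `f₁ ≥ 0` bounded and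
measurable and measurable front factors `χ_k`, then for every selector `sel`:
`(m·m∕M)·(rstepSlot … sel f₁)(s)(V) ≤ (rstepSlot … sel f₂)(s)(V) ≤ (M·M∕m)·(rstepSlot … sel f₁)(s)(V)`.
The R-stepped slot is `f(s)·Σ_{sel a = s} ∫⌈_{Z′(a)} t_a ∕ ∫⌈_{Z′(a)} t_s` ([IV] (0.3)); each fibre integral of `t = χ_k·f` is squeezed (`fibreIntegral_sandwich`), hence each ratio
(`div_sandwich`), the sum, and the product (`mul_sandwich`). [cite: Balaban1989LargeFieldI, (0.3) p.176] -/
theorem rstepSlot_sandwich (sel : SeqOfRecord F ν τ.M g p.K k → SeqOfRecord F ν τ.M g p.K k) {f₁ f₂ : TexpASlot F N ν τ.M p g k} {m M : ℝ}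
    (hm : 0 < m) (hmM : m ≤ M) (h0 : ∀ s V, 0 ≤ f₁ s V) {C : ℝ} (hC : ∀ s V, f₁ s V ≤ C) (hf₁ : ∀ s, Measurable (f₁ s))
    (hχ : ∀ s, Measurable (chiSeqOfRecord F N ν τ.M g p.K k s))
    (hle : ∀ s V, m * f₁ s V ≤ f₂ s V) (hge : ∀ s V, f₂ s V ≤ M * f₁ s V)
    (s : SeqOfRecord F ν τ.M g p.K k) (V : GaugeField (F.P p.K) k (SU N)) :
    m * m / M * rstepSlot F N ν τ p g k sel f₁ s V ≤ rstepSlot F N ν τ p g k sel f₂ s V ∧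
      rstepSlot F N ν τ p g k sel f₂ s V ≤ M * M / m * rstepSlot F N ν τ p g k sel f₁ s V := by
  have hM : 0 < M := lt_of_lt_of_le hm hmM
  -- the terms `t = χ_k·f` (def-R's `rterm` of the two slices) are squeezed, non-negative, bounded, measurable
  have htl : ∀ a U, m * rterm (sliceOfRecord F N ν τ.M p g k f₁) a U ≤ rterm (sliceOfRecord F N ν τ.M p g k f₂) a U := fun a U => by
    show m * (chiSeqOfRecord F N ν τ.M g p.K k a U * f₁ a U) ≤ chiSeqOfRecord F N ν τ.M g p.K k a U * f₂ a U
    rw [mul_left_comm]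
    exact mul_le_mul_of_nonneg_left (hle a U) (chiSeqOfRecord_nonneg F N ν τ.M g p.K k a U)
  have htu : ∀ a U, rterm (sliceOfRecord F N ν τ.M p g k f₂) a U ≤ M * rterm (sliceOfRecord F N ν τ.M p g k f₁) a U := fun a U => by
    show chiSeqOfRecord F N ν τ.M g p.K k a U * f₂ a U ≤ M * (chiSeqOfRecord F N ν τ.M g p.K k a U * f₁ a U)
    rw [mul_left_comm]
    exact mul_le_mul_of_nonneg_left (hge a U) (chiSeqOfRecord_nonneg F N ν τ.M g p.K k a U)
  have htC : ∀ a U, rterm (sliceOfRecord F N ν τ.M p g k f₁) a U ≤ C := fun a U => by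
    show chiSeqOfRecord F N ν τ.M g p.K k a U * f₁ a U ≤ C
    exact (mul_le_mul (chiSeqOfRecord_le_one F N ν τ.M g p.K k a U) (hC a U) (h0 a U) zero_le_one).trans (by rw [one_mul])
  have htm : ∀ a, Measurable (rterm (sliceOfRecord F N ν τ.M p g k f₁) a) := fun a => (hχ a).mul (hf₁ a)
  -- unfold the R-step: slot times the sum of ratios over the selector-fibre
  unfold rstepSlot rstepOfSel
  dsimp only
  unfold rratio
  -- the product of the slot and the sum of ratios is squeezed (`mul_sandwich`), the sum ratio by ratio (`div_sandwich` on `fibreIntegral_sandwich`)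
  refine mul_sandwich hm hmM (h0 s V)
    (Finset.sum_nonneg fun a _ => div_nonneg (fibreIntegral_nonneg' _ _ _) (fibreIntegral_nonneg' _ _ _)) (hle s V) (hge s V) ?_ ?_
  · rw [Finset.mul_sum]
    exact Finset.sum_le_sum fun a _ =>
      (div_sandwich hm hmM (fibreIntegral_nonneg' _ _ _) (fibreIntegral_nonneg' _ _ _)
        (fibreIntegral_sandwich _ (htC a) (htm a) hm.le hM.le (htl a) (htu a) V).1
        (fibreIntegral_sandwich _ (htC a) (htm a) hm.le hM.le (htl a) (htu a) V).2
        (fibreIntegral_sandwich _ (htC s) (htm s) hm.le hM.le (htl s) (htu s) V).1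
        (fibreIntegral_sandwich _ (htC s) (htm s) hm.le hM.le (htl s) (htu s) V).2).1
  · rw [Finset.mul_sum]
    exact Finset.sum_le_sum fun a _ =>
      (div_sandwich hm hmM (fibreIntegral_nonneg' _ _ _) (fibreIntegral_nonneg' _ _ _)
        (fibreIntegral_sandwich _ (htC a) (htm a) hm.le hM.le (htl a) (htu a) V).1
        (fibreIntegral_sandwich _ (htC a) (htm a) hm.le hM.le (htl a) (htu a) V).2
        (fibreIntegral_sandwich _ (htC s) (htm s) hm.le hM.le (htl s) (htu s) V).1
        (fibreIntegral_sandwich _ (htC s) (htm s) hm.le hM.le (htl s) (htu s) V).2).2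

end RStep

/-! ## §3 The 𝐓-step keeps a two-sided squeeze -/

section TStep

variable (ν : Stage7Numerics) (M₀ : ℕ) {p : B12.RunParams} {g : ℕ → ℝ} {k : ℕ}

/-- ★ **THE 𝐓-STEP OF RECORD KEEPS A TWO-SIDED SQUEEZE.**  If `m·T₁ ≤ T₂ ≤ M·T₁` slot-wise and pointwise (`0 ≤ m ≤ M`), with `T₁ ≥ 0` bounded measurable, `T₂`
measurable, non-negative jointly measurable step weights with `|w| ≤ 1` and measurable front factors `χ_k`, then
`m·(tstepOfRecord … w … T₁)(s′)(V′) ≤ (tstepOfRecord … w … T₂)(s′)(V′) ≤ M·(tstepOfRecord … w … T₁)(s′)(V′)` ([III] (3.1): `(†)T(s′)(V′) = h(V′)·∫ w·χ_k·T dκ_{V′}`, the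
averaging kernel is Markov and the integrands are bounded measurable, so `integral_mono` applies). [cite: Balaban1988Convergent, (3.1) p.264, (3.24)–(3.25) p.270] -/
theorem tstepOfRecord_sandwich {w : StepWeightsOfRecord F N ν M₀} (hw0 : ∀ s' U V', 0 ≤ w p g k s' U V') (hwb : ∀ s' U V', |w p g k s' U V'| ≤ 1)
    (hw : ∀ s', Measurable (fun z : GaugeField (F.P p.K) (k + 1) (SU N) × GaugeField (F.P p.K) k (SU N) => w p g k s' z.2 z.1))
    {T₁ T₂ : SeqOfRecord F ν M₀ g p.K k → Density (F.P p.K) k (SU N)} (hT₁m : ∀ s, Measurable (T₁ s)) (hT₂m : ∀ s, Measurable (T₂ s))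
    (h0 : ∀ s U, 0 ≤ T₁ s U) {C : ℝ} (hC : ∀ s U, T₁ s U ≤ C) (hχ : ∀ s, Measurable (chiSeqOfRecord F N ν M₀ g p.K k s))
    {m M : ℝ} (hm : 0 ≤ m) (hmM : m ≤ M) (hle : ∀ s U, m * T₁ s U ≤ T₂ s U) (hge : ∀ s U, T₂ s U ≤ M * T₁ s U)
    (s' : SeqOfRecord F ν M₀ g p.K (k + 1)) (V' : GaugeField (F.P p.K) (k + 1) (SU N)) :
    m * tstepOfRecord F N ν M₀ w p g k T₁ s' V' ≤ tstepOfRecord F N ν M₀ w p g k T₂ s' V' ∧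
      tstepOfRecord F N ν M₀ w p g k T₂ s' V' ≤ M * tstepOfRecord F N ν M₀ w p g k T₁ s' V' := by
  have hM : 0 ≤ M := hm.trans hmM
  have e : ∀ T : SeqOfRecord F ν M₀ g p.K k → Density (F.P p.K) k (SU N), tstepOfRecord F N ν M₀ w p g k T s' V' =
      (avgDensity (avOfRecord F N p.K k).avg V' : ℝ) *
        ∫ U, w p g k s' U V' * (chiSeqOfRecord F N ν M₀ g p.K k s'.init U * T s'.init U) ∂(avgKernel (avOfRecord F N p.K k).avg V') :=
    fun T => texpASucc_apply _ _ _ _ s' V'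
  rw [e T₁, e T₂]
  -- the two integrands: measurable, pointwise squeezed, bounded on the (Markov) averaging kernel at `V′`
  have hwm : Measurable (fun U : GaugeField (F.P p.K) k (SU N) => w p g k s' U V') := (hw s').comp measurable_prodMk_left
  have hm₁ : Measurable (fun U => w p g k s' U V' * (chiSeqOfRecord F N ν M₀ g p.K k s'.init U * T₁ s'.init U)) :=
    hwm.mul ((hχ _).mul (hT₁m _))
  have hm₂ : Measurable (fun U => w p g k s' U V' * (chiSeqOfRecord F N ν M₀ g p.K k s'.init U * T₂ s'.init U)) :=
    hwm.mul ((hχ _).mul (hT₂m _))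
  have hwχ0 : ∀ U, 0 ≤ w p g k s' U V' * chiSeqOfRecord F N ν M₀ g p.K k s'.init U := fun U =>
    mul_nonneg (hw0 s' U V') (chiSeqOfRecord_nonneg F N ν M₀ g p.K k s'.init U)
  have hwχ1 : ∀ U, w p g k s' U V' * chiSeqOfRecord F N ν M₀ g p.K k s'.init U ≤ 1 := fun U => by
    calc w p g k s' U V' * chiSeqOfRecord F N ν M₀ g p.K k s'.init U ≤ 1 * 1 :=
          mul_le_mul ((le_abs_self _).trans (hwb s' U V')) (chiSeqOfRecord_le_one F N ν M₀ g p.K k s'.init U)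
            (chiSeqOfRecord_nonneg F N ν M₀ g p.K k s'.init U) zero_le_one
      _ = 1 := one_mul 1
  have hC0 : 0 ≤ C := by
    obtain ⟨U₀⟩ : Nonempty (GaugeField (F.P p.K) k (SU N)) := ⟨fun _ => 1⟩
    exact (h0 s'.init U₀).trans (hC s'.init U₀)
  have hT₂0 : ∀ U, 0 ≤ T₂ s'.init U := fun U => le_trans (mul_nonneg hm (h0 _ U)) (hle _ U)
  have hT₂C : ∀ U, T₂ s'.init U ≤ M * C := fun U => (hge _ U).trans (mul_le_mul_of_nonneg_left (hC _ U) hM)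
  have hb₁ : ∀ U, ‖w p g k s' U V' * (chiSeqOfRecord F N ν M₀ g p.K k s'.init U * T₁ s'.init U)‖ ≤ C := fun U => by
    rw [Real.norm_eq_abs, ← mul_assoc, abs_of_nonneg (mul_nonneg (hwχ0 U) (h0 _ U))]
    calc w p g k s' U V' * chiSeqOfRecord F N ν M₀ g p.K k s'.init U * T₁ s'.init U ≤ 1 * C :=
          mul_le_mul (hwχ1 U) (hC _ U) (h0 _ U) zero_le_one
      _ = C := one_mul C
  have hb₂ : ∀ U, ‖w p g k s' U V' * (chiSeqOfRecord F N ν M₀ g p.K k s'.init U * T₂ s'.init U)‖ ≤ M * C := fun U => by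
    rw [Real.norm_eq_abs, ← mul_assoc, abs_of_nonneg (mul_nonneg (hwχ0 U) (hT₂0 U))]
    calc w p g k s' U V' * chiSeqOfRecord F N ν M₀ g p.K k s'.init U * T₂ s'.init U ≤ 1 * (M * C) :=
          mul_le_mul (hwχ1 U) (hT₂C U) (hT₂0 U) zero_le_one
      _ = M * C := one_mul _
  have hi₁ : Integrable (fun U => w p g k s' U V' * (chiSeqOfRecord F N ν M₀ g p.K k s'.init U * T₁ s'.init U))
      (avgKernel (avOfRecord F N p.K k).avg V') :=
    (integrable_const C).mono' hm₁.aestronglyMeasurable (ae_of_all _ hb₁)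
  have hi₂ : Integrable (fun U => w p g k s' U V' * (chiSeqOfRecord F N ν M₀ g p.K k s'.init U * T₂ s'.init U))
      (avgKernel (avOfRecord F N p.K k).avg V') :=
    (integrable_const (M * C)).mono' hm₂.aestronglyMeasurable (ae_of_all _ hb₂)
  -- pointwise squeezes of the integrands
  have hpl : ∀ U, m * (w p g k s' U V' * (chiSeqOfRecord F N ν M₀ g p.K k s'.init U * T₁ s'.init U)) ≤
      w p g k s' U V' * (chiSeqOfRecord F N ν M₀ g p.K k s'.init U * T₂ s'.init U) := fun U => by
    calc m * (w p g k s' U V' * (chiSeqOfRecord F N ν M₀ g p.K k s'.init U * T₁ s'.init U))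
        = (w p g k s' U V' * chiSeqOfRecord F N ν M₀ g p.K k s'.init U) * (m * T₁ s'.init U) := by ring
      _ ≤ (w p g k s' U V' * chiSeqOfRecord F N ν M₀ g p.K k s'.init U) * T₂ s'.init U := mul_le_mul_of_nonneg_left (hle _ U) (hwχ0 U)
      _ = w p g k s' U V' * (chiSeqOfRecord F N ν M₀ g p.K k s'.init U * T₂ s'.init U) := by ring
  have hpu : ∀ U, w p g k s' U V' * (chiSeqOfRecord F N ν M₀ g p.K k s'.init U * T₂ s'.init U) ≤
      M * (w p g k s' U V' * (chiSeqOfRecord F N ν M₀ g p.K k s'.init U * T₁ s'.init U)) := fun U => by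
    calc w p g k s' U V' * (chiSeqOfRecord F N ν M₀ g p.K k s'.init U * T₂ s'.init U)
        = (w p g k s' U V' * chiSeqOfRecord F N ν M₀ g p.K k s'.init U) * T₂ s'.init U := by ring
      _ ≤ (w p g k s' U V' * chiSeqOfRecord F N ν M₀ g p.K k s'.init U) * (M * T₁ s'.init U) := mul_le_mul_of_nonneg_left (hge _ U) (hwχ0 U)
      _ = M * (w p g k s' U V' * (chiSeqOfRecord F N ν M₀ g p.K k s'.init U * T₁ s'.init U)) := by ring
  have hIl : m * ∫ U, w p g k s' U V' * (chiSeqOfRecord F N ν M₀ g p.K k s'.init U * T₁ s'.init U) ∂(avgKernel (avOfRecord F N p.K k).avg V') ≤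
      ∫ U, w p g k s' U V' * (chiSeqOfRecord F N ν M₀ g p.K k s'.init U * T₂ s'.init U) ∂(avgKernel (avOfRecord F N p.K k).avg V') := by
    rw [← integral_const_mul]
    exact integral_mono (hi₁.const_mul m) hi₂ hpl
  have hIu : ∫ U, w p g k s' U V' * (chiSeqOfRecord F N ν M₀ g p.K k s'.init U * T₂ s'.init U) ∂(avgKernel (avOfRecord F N p.K k).avg V') ≤
      M * ∫ U, w p g k s' U V' * (chiSeqOfRecord F N ν M₀ g p.K k s'.init U * T₁ s'.init U) ∂(avgKernel (avOfRecord F N p.K k).avg V') := by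
    rw [← integral_const_mul]
    exact integral_mono hi₂ (hi₁.const_mul M) hpu
  have hh : 0 ≤ (avgDensity (avOfRecord F N p.K k).avg V' : ℝ) := NNReal.coe_nonneg _
  constructor
  · calc m * ((avgDensity (avOfRecord F N p.K k).avg V' : ℝ) * _)
        = (avgDensity (avOfRecord F N p.K k).avg V' : ℝ) * (m * _) := by ring
      _ ≤ (avgDensity (avOfRecord F N p.K k).avg V' : ℝ) * _ := mul_le_mul_of_nonneg_left hIl hh
  · calc (avgDensity (avOfRecord F N p.K k).avg V' : ℝ) * _
        ≤ (avgDensity (avOfRecord F N p.K k).avg V' : ℝ) * (M * _) := mul_le_mul_of_nonneg_left hIu hh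
      _ = M * ((avgDensity (avOfRecord F N p.K k).avg V' : ℝ) * _) := by ring

end TStep

end Literature.MathematicalPhysics.QuantumFieldTheory.Balaban1983to89.Node00

end
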